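import Mathlib
import HarnessLib
import HarnessLib.Audit
import Summits.Langlands.Statement
import Literature.NumberTheory.GaloisRepresentations.ProjectiveType
import Literature.NumberTheory.LFunctions.DedekindZeta
import HarnessLib.Audit.Status.Attr

/-!
Route: GaloisWeightedBE

DORMANT since 2026-08-22T18:51:31Z (reconciler: no traction for 5.6 d (last activity item-evidence-added at 2026-08-17T04:26:05Z); parked, not closed — `ledger route dormant route-Langlands-GaloisWeightedBE --off` to reactivate) — unstaffed, not closed; items shared with open routes are served there. `ledger route dormant <id> --off` reactivates.

Route GaloisWeightedBE — realises idea card Langlands/Langlands/galois-weighted-beyond-endoscopy.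
CONDITIONAL on ERH, carried BY NAME:
since the route-choice of 2026-08-16 (operator hold `bridge-only`, option (a)) the declared
conditional_on
`Literature.NumberTheory.LFunctions.ExtendedRiemannHypothesis` IS the route's own LISTED CRUX #4
`ExtendedRiemannHypothesis := that constant`
(verbatim, as in the sibling ERH bridge route-QuantumAdvantage-ThirdFactorialPincer and the LH
bridge route-RiemannHypothesis-LindelofBridge;
home-summit conjecture leaf `Summit.RiemannHypothesis.RiemannHypothesis.ExtendedRiemannHypothesis`;
= RH for every Dedekind zeta function
⇒ GRH for every finite-order Hecke L-function ⇒ every zero AND pole of every Brauer quotient L(s,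
σ⊗χ) lies on Re s = 1/2), and the deciding
theorem takes it as the crux hypothesis `(h₀ : ExtendedRiemannHypothesis)`; C1's antecedent is the
same statement δ-unfolded (`Iff.rfl`).

SECTOR served: the insoluble (icosahedral, BOTH parities — the even case is the open one) n = 2
Artin sector of direction (B) over ℚ,
stated over the summit Statement's own vocabulary (rev 2: no import of Automorphic/StrongArtinGL2 or
GaloisRepresentations/ArtinLFunction):
  Target  StrongArtinIcosahedralQ := ∀ σ : FramedGaloisRep ℚ ℂ 2, σ irreducible → IsIcosahedralType
σ.toMonoidHom →
          ∃ hcpt (π : CuspidalAutomorphicRepData 2 ℚ hcpt), ∀ᶠ v in cofinite, ∃ α,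
π.1.HasSatakeParamAt v α ∧ σ.IsUnramifiedAt v ∧
          σ.HasFrobCharpolyAt v (satakePolynomial α)      (= Tunnell's `IsPiOfArtinRep σ π.1`
inlined, Iff.rfl).

Thesis X (it suffices to show): X := GaloisWeightedCorrelation ∧ MeanSquareRigidity, where b_σ(v) :=
σ.toGaloisRep.frobTrace v
(= tr σ(Frob_v), arithmetic Frobenius, at unramified v; the finitely many ramified v carry a junk
value and contribute O(1)) and a is a
Satake-trace function of π in the UNITARY normalisation (a v = α.sum and ‖α.prod‖ = 1 whenever
π.1.HasSatakeParamAt v α, all but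
finitely many v; ‖α.prod‖ = |ω_π(ϖ_v)| = 1 excludes the |det|^s-twists the datum admits):
  (C1, rank 2, ERH-conditional — the Beyond-Endoscopy output) for every irreducible icosahedral σ
over ℚ there is a cuspidal π on
      GL₂(𝔸_ℚ) whose Frobenius-weighted prime correlation is exactly one: (1/X) Σ_{Nv ≤ X}
a(v)·conj(b_σ(v))·log Nv → 1;
  (C2, rank 3, unconditional rigidity endgame) a cuspidal π of GL₂(𝔸_ℚ) whose Satake traces shadow
an irreducible σ in mean square,
      Σ_{Nv ≤ X} |a(v) − b_σ(v)|² log Nv = o(X), IS π(σ) (the inlined IsPiOfArtinRep clause).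
X → Target: the two support prime-mean-square laws (|a|² and |b_σ|² both average to 1 against log
Nv: simple poles of L(s, π×π̃) and
L(s, σ⊗σ̄), known) turn C1 into C2's hypothesis through |a−b|² = |a|² + |b|² − 2 Re(a b̄).
Lean: DECIDING THEOREM `closes (h₁ : GaloisWeightedCorrelation) (h₂ : MeanSquareRigidity) (h₃ :
RankinSelbergPrimeMeanSquare)
(h₄ : ChebotarevPrimeMeanSquare) (h₅ : SectorComplement) (h₀ : ExtendedRiemannHypothesis) :
Langlands` PROVED in the route file (75 lines,
sorry-free, axioms {propext, Classical.choice, Quot.sound}); the item Assembly is its type.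
SectorComplement :=
StrongArtinIcosahedralQ → Langlands is the COMPLEMENTARY SECTOR — everything in `Langlands` (= ∀ F ∃
𝓡 ∀ n …, both directions, all
places) outside the icosahedral GL₂/ℚ Artin sector — listed as a CRUX of this route (doctrine
2026-08-16: bridges and sectors are
components, every route encompasses its whole summit), ranked last; this route's own mechanism bears
on the sector Target, C1 and C2.

CONDITIONAL on Literature.NumberTheory.LFunctions.ExtendedRiemannHypothesis — this route is an explicit reduction to that named conjecture (D-0019: crux floor waived).

Rationale: WHY THIS LINE. Imports analytic number theory — trace formula + Chebotarev/ERH +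
Selberg-orthogonality rigidity — into direction (B).
The even icosahedral Artin case over ℚ is the one place of the summit where every
cohomological/p-adic engine is provably silent
(Calegari2023 §12; Literature.Barriers.Langlands.NonRegularWeightBarrier) and every converse-theorem
route needs holomorphy (Booker2003,
Booker2006). The card proposes to compute ⟨σ, Spec(GL₂/ℚ)⟩ two ways: the GL₂ trace formula with
Hecke operators T_p inserted, summed over
PRIMES with weights conj(tr σ(Frob_p)) log p (spectral side = Σ_π h(t_π)·corr_π(X)), against the
Eichler–Selberg/Kuznetsov geometric side in
which Frobenius enters only through Chebotarev densities in ℚ(σ)(ζ_m)/ℚ; under ERH every ψ-twisted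
prime sum of tr σ(Frob_p) is
X^{1/2}log²-controlled with INTEGER residues at zeros and poles of the Brauer quotient alike
(LagariasOdlyzko1977, Serre1981), so the
'undetectable residue' obstruction of the integer-n/Voronoi formulation (Booker2006 p.8) is designed
out; Poisson in t (Altug2015, Cheng
arXiv:2505.18967) and a main-term extraction from the dual (f,k)-terms are the open analytic work.
Sources: Venkatesh2004, Herman2011,
Getz2012Nonsolvable, GetzHerman2015, IwaniecKowalski2004 §5.7/ch.16, LiuYe2005, Ramakrishnan1994,
Rajan1999, Murty1994.
Rev 2–3 (route-repair 2026-08-15): statements moved onto the Statement's own vocabulary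
(IsPiOfArtinRep inlined, FramedGaloisRep ℚ ℂ 2,
GaloisRep.frobTrace) so that the import cone no longer carries the eleven unproved Langlands–Tunnell
/ Deligne–Serre / weight-one facts of
StrongArtinGL2 → LanglandsTunnell → NewformGaloisRep / ArtinConductor, none of which any item used;
unitary normalisation ‖α.prod‖ = 1 added
to the Satake clause of C1/C2/S1 (three route-review refuters: S1 was false as typed under |det|^s
twists); deciding theorem `closes` proved.
RANKED CRUXES. Two layers deliberately NOT opened (D-0019).
 #2 GaloisWeightedCorrelation (C1): ERH (all number fields) → ∀ irreducible icosahedral σ/ℚ ∃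
cuspidal π on GL₂(𝔸_ℚ) with unitary Satake
    traces and Frobenius-weighted prime correlation exactly 1. This is the whole Beyond-Endoscopy
analysis (the card's N1+N2) stated by
    its OUTPUT, because the interior (Kuznetsov/Selberg trace formula for Γ₀(q) with Hecke operators
on the Maass ⊕ holomorphic spectrum,
    Poisson-dual families) has no Literature vocabulary yet — tenure splits C1 into 'σ-weighted
prime trace asymptotic' + 'spectral
    isolation' once it lands.
 #3 MeanSquareRigidity (C2): a cuspidal π mean-square-shadowing an irreducible σ IS π(σ). Open
exactly for Maass π (for σ automorphic it is
    Rankin–Selberg orthogonality: distance² ∈ {o(X), 2X}); promoted to a crux because without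
automorphy of σ there is no L(s, π × σ^∨)
    (SolvableImageBarrierNarrow) and no integrality of λ_π(p) (direction (A) at λ = 1/4).
 #4 ExtendedRiemannHypothesis (route-choice 2026-08-16, option (a) of the operator's `bridge-only`
hold): the bridge premise ERH for
    every number field, a listed ranked crux stated BY NAME (`:=
Literature.NumberTheory.LFunctions.ExtendedRiemannHypothesis`, the
    declared conditional_on verbatim — gen 2 of the route-choice replaced gen 0's δ-unfolded
spelling, which the bridge-only audit cannot
    match to the named condition) and the hypothesis `h₀` of `closes`. Load-bearing exactly once: as
the antecedent of C1 (effective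
    Chebotarev in ℚ(σ)(ζ_m)/ℚ; C1 keeps the unfolded antecedent, `Iff.rfl`). Ranked below C1/C2
because this route's work is there; a seat
    handed it answers verdict: open-problem; refutable by name (one zero of one ζ_K off the line);
shared by signature with every
    ERH-conditional thesis (e.g. route-QuantumAdvantage-ThirdFactorialPincer).
 #5 (ranked last) SectorComplement: StrongArtinIcosahedralQ → Langlands, the complementary sector
(global reciprocity for GL_n over every
    number field outside the icosahedral GL₂/ℚ Artin sector). Conjecture-grade, hence a CRUX by the
2026-08-16 doctrine (a sector or
    bridge is a component; the route must encompass the summit) — re-kinded from support in the same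
repair; not where this mechanism bites.
 Support (known or bookkeeping, unranked): RankinSelbergPrimeMeanSquare (PNT for L(s,π×π̃) in the
unitary normalisation, LiuYe2005;
 needs the bridge fact hasSatakeParamAt_iff_L2), ChebotarevPrimeMeanSquare (⟨χ,χ⟩ = 1;
chebotarev_artinRep_holds + a natural-density form),
 Assembly (= the type of `closes`; one-line proof `fun h₁ h₂ h₃ h₄ h₅ h₀ => closes h₁ h₂ h₃ h₄ h₅
h₀`).
 CALIBRATION LADDER (first rungs for provers/refuters, not items): σ dihedral (C1's conclusion
follows from strong Artin for dihedral σ +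
 RS-PNT; the BE derivation must reproduce it = Venkatesh2004 in the σ-weighted normalisation); σ
tetrahedral (first rung where Brauer
 denominators occur, answer known: Langlands–Tunnell); σ ODD icosahedral of conductor 800 (answer
known by KhareWintenberger2009: the
 geometric side MUST return 1 — a falsifiable certified-numerics job); then even A₅ (Doud–Moore /
Jones–Roberts totally real quintics;
 Booker–Lee–Strömbergsson arXiv:1803.06016 λ = 1/4 data for comparison).
KILL CRITERIA. (a) a refuter shows C1's dual side after Poisson in t is term-by-term the spectral
side again (Herman2012 duality made exact
for prime weights), i.e. C1 ⇔ Target with no analytic gain — close as 'restates target'; (b) a proof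
that C2 for Maass π implies
algebraicity of ALL λ = 1/4 Hecke eigenvalues (then C2 = direction (A), re-rank or close); (c)
ERH-conditional counterexample structure: a
cuspidal π with 0 < lim corr_π < 1 for some σ (would refute the integrality of the BE main term and
C2's dichotomy picture); (d) a
kernel-checked `¬ExtendedRiemannHypothesis` (one certified zero of one ζ_K off Re s = 1/2) refutes
crux #4 and closes the route refuted.
NOT DECOMPOSED YET. The trace-formula interior of C1 (vocabulary missing); the sector → summit
typing glue (the inlined IsPiOfArtinRep clause
⇒ Corresponds 𝓡 ι π ρ_ℓ at ALL places for finite-image ρ: JacquetLanglands1970 §12 local converse +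
LLC normalisation) — it needs the
operator's pinning of ReciprocityData and is shared by every Artin-sector route; the odd icosahedral
half of the Target (BuzzardEtAl2001 /
KhareWintenberger2009, in print, not in the tree — grounder g13-35 recommends vendoring
`khareWintenberger_strongArtin_odd`); numerics (kit)
left to the first prover/refuter rung.
CHEAPEST FALSIFIER. Run the σ-weighted geometric side for ONE odd icosahedral σ of conductor 800
(answer forced to be 1 by
KhareWintenberger2009) and for one dihedral σ (Venkatesh2004 normalisation): if the smoothed
elliptic-term computation after Poisson in t
does not visibly converge to 1 — or converges only after inserting the spectral answer by hand (kill
criterion (a)) — the line is dead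
before any even A₅ case is touched.
NOVELTY and BARRIERS: see the dedicated sections (unchanged; searches listed there).

Novelty: Nearest prior art (searched 2026-08-15: zbMATH 'beyond endoscopy' 29 hits, 'nonsolvable base change
descent trace formula', 'trace formula
Artin representation icosahedral', 'Kuznetsov formula Galois representation Frobenius weights' (0
hits), 'Booker poles Artin'; arXiv reads
of Getz2012Nonsolvable pp.1-3 and GetzHerman2015 pp.1-3; lit frontier/bridges Langlands; the card's
own audit refs):
(1) Herman2011 (doi:10.1016/j.jnt.2011.01.019): the Kuznetsov/BE limit weighted by the coefficients
of a FIXED AUTOMORPHIC form g — our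
C1 with σ replaced by g; Venkatesh2004 (doi:10.1515/crll.2004.2004.577.23): monomial weight
η(n)λ_π(n), unconditional; Langlands 2004
(zbl:1078.11033), Altug2015 + arXiv:1506.08911 + arXiv:1512.09249, Cheng
arXiv:2505.18967/2507.09655/2508.07167/2605.20719, Lee
arXiv:2607.03083: the GL₂/ℚ (GL₃) smoothing machinery, no Galois weight anywhere.
(2) Getz2012Nonsolvable (arXiv:1701.01766) and GetzHerman2015 (doi:10.1186/s40687-015-0025-x): the
only trace-formula attacks aimed at
the icosahedral case — BE-style limits of Rankin–Selberg weights tr Sym^j(A ⊗ (A^τ)^{-1}) detecting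
Gal(E/F)-INVARIANT cusp forms over the
big field E, plus a COMPARISON of two trace formulas, giving icosahedral Artin up to abelian twist
CONDITIONAL on trace identities.
(3) Booker2003 / Booker2006 (converse-theorem dichotomy; p.8 of Booker2006: 'undetectably small
residue at a zero of the 6-dim
L-function' for SL₂(F₅)); Murty1994 (Conjecture B ⇒ Artin); Arthur2018 (doi:10.1016/j.aim.20  [refs: 10.1016/j.jnt.2011.01.019, 10.1515/crll.2004.2004.577.23, 10.1186/s40687-015-0025-x, 10.1016/j.aim.2017.06.020:, 10.2140/pjm.2012.260.497, 1506.08911, 1512.09249, 2505.18967, 2607.03083, 1701.01766, 2310.02438, doi:10.1016/j.jnt.2011.01.019, doi:10.1515/crll.2004.2004.577.23, doi:10.1186/s40687-015-0025-x, doi:10.1016/j.aim.2017.06.020, doi:10.2140/pjm.2012.260.497, GetzHerman2015, Herman2011, Ven]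

Barriers (technique_class: beyond-endoscopy trace-formula-limit chebotarev-erh): technique_class: beyond-endoscopy trace-formula-limit chebotarev-erh
- Literature.Barriers.Langlands.SolvableImageBarrier: APPLIES to the target (insoluble image is
exactly what base change / automorphic
  induction cannot reach). C1 evades it by mechanism: no base change or induction of automorphy is
performed; Brauer induction enters
  only through MEROMORPHY + functional equation of L(s, σ⊗ψ) and, over primes, through Chebotarev in
ℚ(σ)(ζ_m)/ℚ (Galois, any group).
- Literature.Barriers.Langlands.SolvableImageBarrierNarrow: APPLIES SQUARELY to the obvious attack
on C2 (Rankin–Selberg L(s, π × σ^∨)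
  via base change of the Maass form π to the fixed fields K_i ⊂ ℚ(σ) of Brauer's elementary
subgroups: K_i/ℚ has insoluble Galois
  closure, so BC of π is unavailable; for holomorphic π of weight ≥ 2 it is available through
totally-real base change, Dieulefait2012-type
  results, which is why C2 is open only for Maass π). NOT evaded: the bet is a rigidity internal to
GL₂/ℚ — a second-moment
  Galois-weighted BE identity à la Herman2011, or discreteness of Hecke eigenvalues of the shadowing
π.
- Literature.Barriers.Langlands.NonRegularWeightBarrier: evaded — no cohomology, no p-adic
interpolation; the trace formula sees
  λ = 1/4 Maass forms and weight one on the same footing (C1 is parity-blind); C2 is where irregular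
weight bites back (no Galois
  representation / integrality for the shadowing Maass π), declared in its why-might-fail.
- Literature.Barriers.Langlands.TwistedEndosc

Novelty grade: new-combination — ROUTE REVIEW grade (refuter 2f46c378-g2, 2026-08-15; closes the grade gen-1 left open). new-combination = (A) Herman2011's RS-weighted Beyond Endoscopy on GL₂/ℚ with the fixed automorphic g replaced by a fixed Galois σ + (B) effective Chebotarev under ERH (LagariasOdlyzko1977, Serre1981) closing the (refuter refuter-rreview-route-HubbardSuperconduc-2f46c378-g2-0, 2026-08-15T12:56:20Z; prior: Herman2011 doi:10.1016/j.jnt.2011.01.019 (arXiv:1003.0462) — BE for Rankin–Selberg, Kuznetsov weighted by a FIXED automorphic g, Venkatesh2004 doi:10.1515/crll.2004.2004.577.23 — dihedral BE; §5 Galois-type forms counted by amplifiers in λ_f(p^{2k}), Langlands 2004 'Beyond Endoscopy' zbl:1078.11033 — weights tr ρ(A_p(π)) in π's own Satake data (not held; recollection), Sarnak 2001 letter 'Comments)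

History (route lifecycle, newest last):
- 2026-08-15T16:25:07Z · rev 2: restated StrongArtinIcosahedralQ (stmt-Langlands-1272), GaloisWeightedCorrelation (stmt-Langlands-1273), MeanSquareRigidity (stmt-Langlands-1274), RankinSelbergPrimeMeanSquare (stmt-Langlands-1275), ChebotarevPrimeMeanSquare (stmt-Langlands-1276) — route-repair (unit rbadge-Langlands-GaloisWeightedBE-b7d5a154-g4 (planner-rbadge-Langlands-GaloisWeightedBE-b7d5a154-g4-0)
- 2026-08-15T16:52:16Z · rev 3: restated GaloisWeightedCorrelation (stmt-Langlands-10842), Assembly (stmt-Langlands-1278) — route-repair (rbadge g4), step 2: STAFFABILITY. After rev 2 the gate's used-constants cone had exactly one unproved dep: `Literature.NumberTheory.LFunctions.Num (planner-rbadge-Langlands-GaloisWeightedBE-b7d5a154-g4-0)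
- 2026-08-15T16:54:29Z · rev 4: restated ERHAllNumberFields (stmt-Langlands-11117), GaloisWeightedCorrelation (stmt-Langlands-11115), Assembly (stmt-Langlands-11116) — route-repair (rbadge g4), step 3 (fallback F′ announced in step 2's note): rev 3 confirmed the gate keeps conditional_on = `ExtendedRiemannHypothesis` on edit a (planner-rbadge-Langlands-GaloisWeightedBE-b7d5a154-g4-0)
- 2026-08-16T03:23:04Z · rev 6: restated Assembly (stmt-Langlands-11210) — route-choice follow-up (edit B): Assembly restated to the type of the re-glued `closes` (… → SectorComplement → ExtendedRiemannHypothesis → Langlands) and the s (planner-rchoice-Langlands-GaloisWeightedBE-bri-be046896-0)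
- 2026-08-16T03:23:04Z · rev 6: dropped ERHAllNumberFields — route-choice follow-up (edit B): Assembly restated to the type of the re-glued `closes` (… → SectorComplement → ExtendedRiemannHypothesis → Langlands) and the s (planner-rchoice-Langlands-GaloisWeightedBE-bri-be046896-0)
- 2026-08-16T03:55:56Z · rev 7: restated ExtendedRiemannHypothesis (stmt-Langlands-14314) — route-choice gen 2 (unit rchoice-Langlands-GaloisWeightedBE-bri-be046896-g2; operator hold bridge-only 2026-08-16T02:41Z), OPTION (a) carried out BY NAME: crux (planner-rchoice-Langlands-GaloisWeightedBE-bri-be046896-g2-0)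
- 2026-08-22T18:51:31Z · DORMANT — reconciler: no traction for 5.6 d (last activity item-evidence-added at 2026-08-17T04:26:05Z); parked, not closed — `ledger route dormant route-Langlands-Galois (operator:999:1518943)

sub-problem: Langlands · status: dormant · opened planner-plancard-Langlands-Langlands-galois-w-af3002b5-0 2026-08-15T10:54:18Z · rev 7 · ledger route-Langlands-GaloisWeightedBE
GENERATED by the gate from the ledger (D-0016/17). Provers cite these decls: `theorem foo : Summit.Langlands.Langlands.Theses.GaloisWeightedBE.<Decl> := …` in Summits/Langlands/Langlands/Theorems/<Name>.lean.
-/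

namespace Summit.Langlands.Langlands.Theses.GaloisWeightedBE

open scoped BigOperators Topology Manifold Classical MeasureTheory ProbabilityTheory Matrix InnerProductSpace ComplexConjugate ContinuousMap
open Filter Set Function TopologicalSpace MeasureTheory

attribute [summit_statement] _root_.Langlands
attribute [route_premise "route-Langlands-GaloisWeightedBE"] _root_.Literature.NumberTheory.LFunctions.ExtendedRiemannHypothesis

-- earlier StrongArtinIcosahedralQ (stmt-Langlands-1272, replaced 2026-08-15T16:25:07Z -> stmt-Langlands-10841): retired by None — ∀ σ : Literature.NumberTheory.GaloisRepresentations.FramedArtinRep ℚ 2, σ.toGaloisRep.IsIrreducible → Literature.NumberTheory.GaloisRepresentations.IsIcosahedralType σ.toMonoidHom → ∃ (hcpt : Literature.NumberTheory.Automorphic.isCompact_glFiniteIntegralLevel 2 ℚ) (π : Li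
/-- item stmt-Langlands-10841 · target · rank 0 · open · by planner
why it might fail: False iff some even A₅-type ρ over ℚ is not automorphic (no evidence; Booker–Lee–Strömbergsson λ=1/4 data consistent). As a PROVABLE statement the even case has resisted every method (Calegari2023 §12): cohomology is blind, converse theorems need holomorphy.
sources: Calegari2023, KhareWintenberger2009, BuzzardEtAl2001, Tunnell1981, arXiv:1803.06016
[target] Strong Artin conjecture for GL₂ over ℚ in the insoluble case: every irreducible σ : Γ_ℚ →
GL₂(ℂ) (`FramedGaloisRep ℚ ℂ 2` = `FramedArtinRep ℚ 2` unfolded) of icosahedral projective type (A₅)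
has a cuspidal π(σ) on GL₂(𝔸_ℚ) in Tunnell's almost-everywhere sense — for all but finitely many
finite v, π has a Satake parameter α at v, σ is unramified at v and every arithmetic Frobenius at v
has characteristic polynomial ∏_{a∈α}(X − a) (this is `Automorphic.IsPiOfArtinRep σ π.1` of
Automorphic/StrongArtinGL2 INLINED verbatim, `Iff.rfl`, so that the route no longer imports
StrongArtinGL2 and its eleven unproved Langlands–Tunnell / Deligne–Serre / weight-one facts). Odd σ:
a theorem in print (BuzzardEtAl2001 Thm A, KhareWintenberger2009 Thm 10.1(ii) + the weight-one
dictionary) but NOT in the tree; even σ (totally real A₅-quintic fields): open — 'not a single case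
known' (Calegari2023 §12). This is the n = 2 insoluble Artin sector of direction (B) of the summit
over ℚ, stated 𝓡-free; the sector → `Corresponds 𝓡 ι π ρ_ℓ` typing glue awaits the pinning of
ReciprocityData and is deliberately not an item. -/
@[route_item "route-Langlands-GaloisWeightedBE"]
def StrongArtinIcosahedralQ : Prop :=
  ∀ σ : Literature.NumberTheory.GaloisRepresentations.FramedGaloisRep ℚ ℂ 2, σ.toGaloisRep.IsIrreducible → Literature.NumberTheory.GaloisRepresentations.IsIcosahedralType σ.toMonoidHom → ∃ (hcpt : Literature.NumberTheory.Automorphic.isCompact_glFiniteIntegralLevel 2 ℚ) (π : Literature.NumberTheory.Automorphic.CuspidalAutomorphicRepData 2 ℚ hcpt), ∀ᶠ v in cofinite, ∃ α : Multiset ℂ, π.1.HasSatakeParamAt v α ∧ σ.IsUnramifiedAt v ∧ σ.HasFrobCharpolyAt v (Literature.NumberTheory.Automorphic.satakePolynomial α)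

-- earlier GaloisWeightedCorrelation (stmt-Langlands-10842, replaced 2026-08-15T16:52:16Z -> stmt-Langlands-11115): retired by None — Literature.NumberTheory.LFunctions.ExtendedRiemannHypothesis → ∀ σ : Literature.NumberTheory.GaloisRepresentations.FramedGaloisRep ℚ ℂ 2, σ.toGaloisRep.IsIrreducible → Literature.NumberTheory.GaloisRepresentations.IsIcosahedralType σ.toMonoidHom → ∃ (hcpt : Literature.
-- earlier GaloisWeightedCorrelation (stmt-Langlands-11115, replaced 2026-08-15T16:54:29Z -> stmt-Langlands-11209): retired by None — (∀ (K : Type) [Field K] [NumberField K], Literature.NumberTheory.LFunctions.NumberField.ExtendedRiemannHypothesis K) → ∀ σ : Literature.NumberTheory.GaloisRepresentations.FramedGaloisRep ℚ ℂ 2, σ.toGaloisRep.IsIrreducible → Literature.NumberTheory.GaloisRepresentations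
-- earlier GaloisWeightedCorrelation (stmt-Langlands-1273, replaced 2026-08-15T16:25:07Z -> stmt-Langlands-10842): retired by None — Literature.NumberTheory.LFunctions.ExtendedRiemannHypothesis → ∀ σ : Literature.NumberTheory.GaloisRepresentations.FramedArtinRep ℚ 2, σ.toGaloisRep.IsIrreducible → Literature.NumberTheory.GaloisRepresentations.IsIcosahedralType σ.toMonoidHom → ∃ (hcpt : Literature.Numb
/-- item stmt-Langlands-11209 · crux · rank 2 · open · by planner
why it might fail: After Poisson in t the dual (f,k)-terms are a spectral sum in disguise (Herman2012): ERH+Chebotarev bound each prime sum by X^{1/2+ε} but there are ~X^{1/2} of them — total X^{1+ε} vs main term X. Extracting the main term may be exactly as hard as the target (no analytic gain).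
sources: Herman2011, Herman2012, Venkatesh2004, Altug2015, arXiv:2505.18967, LagariasOdlyzko1977
[crux] ERH for every number field (the premise = `ExtendedRiemannHypothesis` written fully unfolded,
`∀ K s, dedekindZetaCont K s = 0 → 0 < Re s < 1 → Re s = 1/2`, definitionally the support item
ERHAllNumberFields) ⇒ for every irreducible icosahedral σ over ℚ there are a cuspidal π on GL₂(𝔸_ℚ)
and a Satake-trace function a in the UNITARY normalisation (a v = α.sum and ‖α.prod‖ = 1 whenever
π.1.HasSatakeParamAt v α, all but finitely many v — the clause ‖α.prod‖ = 1, i.e. |ω_π(ϖ_v)| = 1,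
excludes the |det|^s-twists that the datum CuspidalAutomorphicRepData admits; refuter objection on
the old S1) with (1/X) Σ_{Nv≤X} a(v)·conj(b_σ(v))·log Nv → 1, where b_σ(v) :=
σ.toGaloisRep.frobTrace v = tr σ(Frob_v) (arithmetic Frobenius; junk at the finitely many ramified
v, an O(1) contribution). MECHANISM = Beyond Endoscopy weighted by σ OVER PRIMES: Σ_{p≤X}
conj(b_σ(p)) log p · tr(T_p ∘ h(Δ) | cusp forms of level q_σ, character det σ) computed
geometrically (Eichler–Selberg / Kuznetsov); identity and hyperbolic terms carry no main term (σ
irreducible non-trivial ⇒ L(s,σ⊗ψ) regular non-zero at s=1, known); elliptic terms: H(t²−4p) →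
L(1,χ_{t²−4p}) with Altug2015/Cheng smoothing, Poisson in t, a -/
@[route_item "route-Langlands-GaloisWeightedBE", crux]
def GaloisWeightedCorrelation : Prop :=
  (∀ (K : Type) [Field K] [NumberField K] (s : ℂ), Literature.NumberTheory.LFunctions.dedekindZetaCont K s = 0 → 0 < s.re → s.re < 1 → s.re = 1 / 2) → ∀ σ : Literature.NumberTheory.GaloisRepresentations.FramedGaloisRep ℚ ℂ 2, σ.toGaloisRep.IsIrreducible → Literature.NumberTheory.GaloisRepresentations.IsIcosahedralType σ.toMonoidHom → ∃ (hcpt : Literature.NumberTheory.Automorphic.isCompact_glFiniteIntegralLevel 2 ℚ) (π : Literature.NumberTheory.Automorphic.CuspidalAutomorphicRepData 2 ℚ hcpt) (a : IsDedekindDomain.HeightOneSpectrum (NumberField.RingOfIntegers ℚ) → ℂ), (∀ᶠ v in cofinite, ∃ α : Multiset ℂ, π.1.HasSatakeParamAt v α ∧ ‖α.prod‖ = 1 ∧ a v = α.sum) ∧ Tendsto (fun X : ℝ => (∑ᶠ v ∈ {v : IsDedekindDomain.HeightOneSpectrum (NumberField.RingOfIntegers ℚ) | (v.residueCard : ℝ)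 ≤ X}, a v * conj (σ.toGaloisRep.frobTrace v) * (Real.log (v.residueCard : ℝ) : ℂ)) / (X : ℂ)) atTop (𝓝 1)

-- earlier MeanSquareRigidity (stmt-Langlands-1274, replaced 2026-08-15T16:25:07Z -> stmt-Langlands-10843): retired by None — ∀ (σ : Literature.NumberTheory.GaloisRepresentations.FramedArtinRep ℚ 2), σ.toGaloisRep.IsIrreducible → ∀ (hcpt : Literature.NumberTheory.Automorphic.isCompact_glFiniteIntegralLevel 2 ℚ) (π : Literature.NumberTheory.Automorphic.CuspidalAutomorphicRepData 2 ℚ hcpt) (a : IsDedek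
/-- item stmt-Langlands-10843 · crux · rank 3 · open · by planner
why it might fail: For Maass π nothing known forces a.e. EQUALITY from mean-square closeness: no Galois representation, no integrality of λ_π(p), no L(s,π×σ^∨) without automorphy of σ. It may be provable only through strong Artin itself, or turn out equivalent to algebraicity at λ=1/4.
sources: LiuYe2005, Ramakrishnan1994, Rajan1999, arXiv:1806.08429, Murty1994, Dieulefait2012
[crux] Rigidity endgame, UNCONDITIONAL and for every irreducible σ : Γ_ℚ → GL₂(ℂ): if a cuspidal π
on GL₂(𝔸_ℚ) has unitary-normalised Satake traces a (a v = α.sum, ‖α.prod‖ = 1 a.e.) with Σ_{Nv≤X}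
|a(v) − tr σ(Frob_v)|² log Nv = o(X) (tr σ(Frob_v) = σ.toGaloisRep.frobTrace v), then π = π(σ)
almost everywhere (the inlined `IsPiOfArtinRep`: cofinitely many v with Satake parameter α, σ
unramified, charpoly of arithmetic Frobenius = ∏(X − a)). If σ is automorphic this is Rankin–Selberg
/ Selberg orthogonality (LiuYe2005: the distance² is either o(X) or ∼2X) plus the
Ramakrishnan1994/Rajan1999 refinement of strong multiplicity one; the open content is σ insoluble
and π Maass, where neither L(s, π × σ^∨) (no base change of π to the non-normal subfields of ℚ(σ)
cut out by Brauer's elementary subgroups: Literature.Barriers.Langlands.SolvableImageBarrierNarrow)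
nor integrality of λ_π(p) (direction (A) at λ = 1/4) is available. Candidate lines: a second-moment
Galois-weighted BE identity (Herman2011 with weights b_σ(p)·conj b_σ(p′)); a Frobenian large sieve;
discreteness of the set of cusp forms shadowing a fixed σ; Ramakrishnan arXiv:1806.08429-type
comparison. Twist audit (refuters 9bee0ce -/
@[route_item "route-Langlands-GaloisWeightedBE", crux]
def MeanSquareRigidity : Prop :=
  ∀ σ : Literature.NumberTheory.GaloisRepresentations.FramedGaloisRep ℚ ℂ 2, σ.toGaloisRep.IsIrreducible → ∀ (hcpt : Literature.NumberTheory.Automorphic.isCompact_glFiniteIntegralLevel 2 ℚ) (π : Literature.NumberTheory.Automorphic.CuspidalAutomorphicRepData 2 ℚ hcpt) (a : IsDedekindDomain.HeightOneSpectrum (NumberField.RingOfIntegers ℚ) → ℂ), (∀ᶠ v in cofinite, ∃ α : Multiset ℂ, π.1.HasSatakeParamAt v α ∧ ‖α.prod‖ = 1 ∧ a v = α.sum) → (fun X : ℝ => ∑ᶠ v ∈ {v : IsDedekindDomain.HeightOneSpectrum (NumberField.RingOfIntegers ℚ) | (v.residueCard : ℝ) ≤ X}, ‖a v - σ.toGaloisRep.frobTrace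 v‖ ^ 2 * Real.log (v.residueCard : ℝ)) =o[atTop] (fun X : ℝ => X) → ∀ᶠ v in cofinite, ∃ α : Multiset ℂ, π.1.HasSatakeParamAt v α ∧ σ.IsUnramifiedAt v ∧ σ.HasFrobCharpolyAt v (Literature.NumberTheory.Automorphic.satakePolynomial α)

-- earlier ExtendedRiemannHypothesis (stmt-Langlands-14314, replaced 2026-08-16T03:55:56Z -> stmt-Langlands-14565): retired by None — (/ - crux = the Extended Riemann Hypothesis BY NAME: Literature.NumberTheory.LFunctions.ExtendedRiemannHypothesis (this route's conditional_on; home-summit conjecture leaf Summit.RiemannHypothesis.RiemannHypothesis.ExtendedRiemannHypothesis), written δ-unfolded through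
/-- item stmt-Langlands-14565 · crux · rank 4 · open · by planner
why it might fail: It is ERH itself (for K = ℚ already Mathlib's RiemannHypothesis): open, no strategy in sight; a single zero of a single ζ_K off Re s = 1/2 — e.g. a Siegel zero of a quadratic field, excluded by no theorem — makes it false and voids C1's Chebotarev error terms.
sources: IwaniecKowalski2004, Bordelles2020, LagariasOdlyzko1977, Serre1981
[crux] THE PREMISE of this conditional bridge, BY NAME: the Extended Riemann Hypothesis for the
Dedekind zeta function of every number field K (every zero of ζ_K — Hecke's continuation
`dedekindZetaCont K` — in the open strip 0 < Re s < 1 lies on Re s = 1/2) =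
`Literature.NumberTheory.LFunctions.ExtendedRiemannHypothesis` VERBATIM: the route's declared
conditional_on and `route_premise` constant (@[conjecture], [status: open]; home-summit conjecture
leaf `Summit.RiemannHypothesis.RiemannHypothesis.ExtendedRiemannHypothesis`, same body).
ROUTE-CHOICE 2026-08-16, operator hold `bridge-only` ('conditional on … which is not one of the
route's cruxes'), option (a) 'add ExtendedRiemannHypothesis as a crux': gen 0 of the route-choice
filed this crux δ-unfolded (stmt-Langlands-14314: ∀ K s, dedekindZetaCont K s = 0 → 0 < Re s < 1 →
Re s = 1/2, `Iff.rfl` with the constant — refuter 14314-0 / grounder g39-5 stamps of 03:33Z carry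
over verbatim, the statement is definitionally unchanged); gen 2 restates it BY NAME so that the
named condition literally is a listed crux (as on route-RiemannHypothesis-LindelofBridge and
route-QuantumAdvantage-ThirdFactorialPincer). It is the hypothesis `h₀` of t -/
@[route_item "route-Langlands-GaloisWeightedBE", crux]
def ExtendedRiemannHypothesis : Prop :=
  Literature.NumberTheory.LFunctions.ExtendedRiemannHypothesis

/-- item stmt-Langlands-1277 · crux · rank 9 · open · by planner
why it might fail: It is global Langlands reciprocity for GL_n over every number field outside one GL₂/ℚ sector: both directions, all n, compatibility at every place. (A) for non-regular π and (B) beyond regular ρ are wide open (Calegari2023); and `Langlands` as typed (∃𝓡 pinning, all places) may over-claim.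
sources: BuzzardGeeLMS2014, Calegari2023, FontaineMazurGeometric1995
[support] COMPLEMENT OF THE SECTOR = the rest of the summit: `StrongArtinIcosahedralQ → Langlands`.
NOT attacked by this route and not expected to close before the summit itself; filed only so that
the Assembly's consequent is the summit constant `Langlands` (D-0016 convention: `∀ F ∃ 𝓡 ∀ n …`
cannot follow from one sector) while the route's real target is the sector statement
StrongArtinIcosahedralQ. Trivially implied by `Langlands`; intended to be shared (dedup by
signature) by every route into this sector. Refuters/graders: judge the route on Target /
GaloisWeightedCorrelation / MeanSquareRigidity, not on this item. -/
@[route_item "route-Langlands-GaloisWeightedBE", crux]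
def SectorComplement : Prop :=
  StrongArtinIcosahedralQ → Langlands

-- earlier RankinSelbergPrimeMeanSquare (stmt-Langlands-1275, replaced 2026-08-15T16:25:07Z -> stmt-Langlands-10844): retired by None — ∀ (hcpt : Literature.NumberTheory.Automorphic.isCompact_glFiniteIntegralLevel 2 ℚ) (π : Literature.NumberTheory.Automorphic.CuspidalAutomorphicRepData 2 ℚ hcpt) (a : IsDedekindDomain.HeightOneSpectrum (NumberField.RingOfIntegers ℚ) → ℂ), (∀ᶠ v in cofinite, ∃ α : Mult
/-- item stmt-Langlands-10844 · support · rank 9 · open · by planner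
sources: LiuYe2005, IwaniecKowalski2004
[support] KNOWN (retyped after the refuter objection on stmt-Langlands-1275): for every cuspidal π
on GL₂(𝔸_ℚ) and every Satake-trace function a of π in the UNITARY normalisation (a v = α.sum with
‖α.prod‖ = 1, i.e. |ω_π(ϖ_v)| = 1, at all but finitely many v — this pins Re s = 0 in π = π₀ ⊗
|det|^s, so π is unitary cuspidal), Σ_{Nv≤X} |a(v)|² log Nv ∼ X — the prime number theorem for L(s,
π × π̃) (simple pole at s = 1 by Rankin–Selberg, non-vanishing on Re s = 1 by Shahidi, non-negative
coefficients + Wiener–Ikehara; LiuYe2005 / Liu–Ye 2007, IwaniecKowalski2004 Thm 5.13 with §5.12;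
prime squares negligible by the Kim–Sarnak bound). Finitely many exceptional v where a is
unconstrained contribute O(1). Bridging the datum π = W/W′ to the L² theory uses the named facts
exists_isAssociatedL2 / hasSatakeParamAt_iff_L2 of AutomorphicRepsGL. -/
@[route_item "route-Langlands-GaloisWeightedBE", crux]
def RankinSelbergPrimeMeanSquare : Prop :=
  ∀ (hcpt : Literature.NumberTheory.Automorphic.isCompact_glFiniteIntegralLevel 2 ℚ) (π : Literature.NumberTheory.Automorphic.CuspidalAutomorphicRepData 2 ℚ hcpt) (a : IsDedekindDomain.HeightOneSpectrum (NumberField.RingOfIntegers ℚ) → ℂ), (∀ᶠ v in cofinite, ∃ α : Multiset ℂ, π.1.HasSatakeParamAt v α ∧ ‖α.prod‖ = 1 ∧ a v = α.sum) → Tendsto (fun X : ℝ => (∑ᶠ v ∈ {v : IsDedekindDomain.HeightOneSpectrum (NumberField.RingOfIntegers ℚ) | (v.residueCard : ℝ) ≤ X}, ‖a v‖ ^ 2 * Real.log (v.residueCard : ℝ)) / X) atTop (𝓝 1)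

-- earlier ChebotarevPrimeMeanSquare (stmt-Langlands-1276, replaced 2026-08-15T16:25:07Z -> stmt-Langlands-10845): retired by None — ∀ σ : Literature.NumberTheory.GaloisRepresentations.FramedArtinRep ℚ 2, σ.toGaloisRep.IsIrreducible → Tendsto (fun X : ℝ => (∑ᶠ v ∈ {v : IsDedekindDomain.HeightOneSpectrum (NumberField.RingOfIntegers ℚ) | (v.residueCard : ℝ) ≤ X}, ‖(σ.toArtinRep.eulerFactorAt v).coeff 1
/-- item stmt-Langlands-10845 · support · rank 9 · open · by planner
sources: Serre1981, LagariasOdlyzko1977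
[support] KNOWN: for irreducible σ : Γ_ℚ → GL₂(ℂ), Σ_{Nv≤X} |tr σ(Frob_v)|² log Nv ∼ X with tr
σ(Frob_v) := σ.toGaloisRep.frobTrace v (arithmetic Frobenius; at the finitely many ramified v the
value is GaloisRep.frobCharpoly's documented junk, an O(1) contribution) — the Chebotarev density
theorem with log weights, conjugacy class by class in Gal(ℚ(σ)/ℚ) (⟨χ_σ, χ_σ⟩ = 1); equivalently the
simple pole of L(s, σ ⊗ σ̄) at s = 1 with no other zero or pole on Re s = 1 (Brauer + Hecke). Tree:
chebotarev_artinRep_holds (ChebotarevArtinRepHolds), ChebotarevDensity*,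
hasFrobCharpolyAt_frobCharpoly / HasFrobCharpolyAt.unique (GaloisRep); the natural-density
(prime-counting) form may need one vendored fact (LagariasOdlyzko1977 Thm 1.1 / Serre1981 §2). -/
@[route_item "route-Langlands-GaloisWeightedBE", crux]
def ChebotarevPrimeMeanSquare : Prop :=
  ∀ σ : Literature.NumberTheory.GaloisRepresentations.FramedGaloisRep ℚ ℂ 2, σ.toGaloisRep.IsIrreducible → Tendsto (fun X : ℝ => (∑ᶠ v ∈ {v : IsDedekindDomain.HeightOneSpectrum (NumberField.RingOfIntegers ℚ) | (v.residueCard : ℝ) ≤ X}, ‖σ.toGaloisRep.frobTrace v‖ ^ 2 * Real.log (v.residueCard : ℝ)) / X) atTop (𝓝 1)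

-- earlier Assembly (stmt-Langlands-11116, replaced 2026-08-15T16:54:29Z -> stmt-Langlands-11210): retired by None — GaloisWeightedCorrelation → MeanSquareRigidity → RankinSelbergPrimeMeanSquare → ChebotarevPrimeMeanSquare → SectorComplement → (∀ (K : Type) [Field K] [NumberField K], Literature.NumberTheory.LFunctions.NumberField.ExtendedRiemannHypothesis K) → Langlands
-- earlier Assembly (stmt-Langlands-11210, replaced 2026-08-16T03:23:04Z -> stmt-Langlands-14414): retired by None — GaloisWeightedCorrelation → MeanSquareRigidity → RankinSelbergPrimeMeanSquare → ChebotarevPrimeMeanSquare → SectorComplement → ERHAllNumberFields → Langlands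
-- earlier Assembly (stmt-Langlands-1278, replaced 2026-08-15T16:52:16Z -> stmt-Langlands-11116): retired by None — GaloisWeightedCorrelation → MeanSquareRigidity → RankinSelbergPrimeMeanSquare → ChebotarevPrimeMeanSquare → SectorComplement → Literature.NumberTheory.LFunctions.ExtendedRiemannHypothesis → Langlands
/-- item stmt-Langlands-14414 · assembly · rank 1 · open · by planner
[assembly] GaloisWeightedCorrelation → MeanSquareRigidity → RankinSelbergPrimeMeanSquare →
ChebotarevPrimeMeanSquare → SectorComplement → ExtendedRiemannHypothesis → Langlands — literally the
type of the route's deciding theorem `closes` (D-0027 §2.1) after the route-choice of 2026-08-16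
(crux #4 ExtendedRiemannHypothesis replaces the support carrier ERHAllNumberFields as h₀; same
proof, 75 lines, sorry-free, axioms {propext, Classical.choice, Quot.sound}): finiteness of {v | Nv
≤ X} (Ideal.finite_setOf_absNorm_le pulled back along v ↦ v.asIdeal), finsums become Finset sums,
termwise ‖a − b‖² = ‖a‖² + ‖b‖² − 2Re(a·conj b), so (S1 + S2 − 2·Re C1)/X → 1 + 1 − 2 = 0,
`Asymptotics.isLittleO_iff_tendsto'`, then C2 gives π = π(σ) a.e. and the complementary-sector crux
SectorComplement closes `Langlands`. A prover closes this item with the one-liner `theorem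
Assembly_holds : Assembly := closes` (or `fun h₁ h₂ h₃ h₄ h₅ h₀ => closes h₁ h₂ h₃ h₄ h₅ h₀`). -/
@[route_item "route-Langlands-GaloisWeightedBE"]
def Assembly : Prop :=
  GaloisWeightedCorrelation → MeanSquareRigidity → RankinSelbergPrimeMeanSquare → ChebotarevPrimeMeanSquare → SectorComplement → ExtendedRiemannHypothesis → Langlands

-- records of items no longer active in this route (dropped / restated):
-- earlier ERHAllNumberFields (stmt-Langlands-11117, replaced 2026-08-15T16:54:29Z -> stmt-Langlands-11208): retired by None — ∀ (K : Type) [Field K] [NumberField K], Literature.NumberTheory.LFunctions.NumberField.ExtendedRiemannHypothesis K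

/-! D-0027 §2.1 — DECIDING THEOREM (planner-authored via `route open/edit --closes-file`; by planner-rchoice-Langlands-GaloisWeightedBE-bri-be046896-g2-0 2026-08-16T03:55:56Z):
its hypotheses are this route's items and its conclusion the sub-problem Statement (glue_lint), and it elaborates with this file. -/

@[closes "route-Langlands-GaloisWeightedBE"] theorem closes (h₁ : GaloisWeightedCorrelation) (h₂ : MeanSquareRigidity)
    (h₃ : RankinSelbergPrimeMeanSquare) (h₄ : ChebotarevPrimeMeanSquare) (h₅ : SectorComplement)
    (h₀ : ExtendedRiemannHypothesis) : Langlands := by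
  -- (1) the elementary mean-square algebra: three prime-sum limits `→ 1` give `Σ ‖a-b‖² w = o(X)`
  have key : ∀ (S : ℝ → Set (IsDedekindDomain.HeightOneSpectrum (NumberField.RingOfIntegers ℚ)))
      (a b : IsDedekindDomain.HeightOneSpectrum (NumberField.RingOfIntegers ℚ) → ℂ)
      (w : IsDedekindDomain.HeightOneSpectrum (NumberField.RingOfIntegers ℚ) → ℝ),
      (∀ X, (S X).Finite) →
      Tendsto (fun X : ℝ => (∑ᶠ v ∈ S X, a v * conj (b v) * (w v : ℂ)) / (X : ℂ)) atTop (𝓝 1) →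
      Tendsto (fun X : ℝ => (∑ᶠ v ∈ S X, ‖a v‖ ^ 2 * w v) / X) atTop (𝓝 1) →
      Tendsto (fun X : ℝ => (∑ᶠ v ∈ S X, ‖b v‖ ^ 2 * w v) / X) atTop (𝓝 1) →
      (fun X : ℝ => ∑ᶠ v ∈ S X, ‖a v - b v‖ ^ 2 * w v) =o[atTop] (fun X : ℝ => X) := by
    intro S a b w hS hab ha hb
    have hpt : ∀ X : ℝ, ∑ᶠ v ∈ S X, ‖a v - b v‖ ^ 2 * w v
        = (∑ᶠ v ∈ S X, ‖a v‖ ^ 2 * w v) + (∑ᶠ v ∈ S X, ‖b v‖ ^ 2 * w v)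
          - 2 * (∑ᶠ v ∈ S X, a v * conj (b v) * (w v : ℂ)).re := by
      intro X
      simp only [finsum_mem_eq_finite_toFinset_sum _ (hS X)]
      rw [Complex.re_sum, Finset.mul_sum, ← Finset.sum_add_distrib, ← Finset.sum_sub_distrib]
      refine Finset.sum_congr rfl fun v _ => ?_
      have hsq : ‖a v - b v‖ ^ 2 = ‖a v‖ ^ 2 + ‖b v‖ ^ 2 - 2 * (a v * conj (b v)).re := by
        rw [Complex.sq_norm, Complex.sq_norm, Complex.sq_norm, Complex.normSq_sub]
      rw [hsq, Complex.re_mul_ofReal]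
      ring
    have hre : Tendsto (fun X : ℝ => (∑ᶠ v ∈ S X, a v * conj (b v) * (w v : ℂ)).re / X)
        atTop (𝓝 1) := by
      have h := (Complex.continuous_re.tendsto 1).comp hab
      simpa [Function.comp_def, Complex.div_ofReal_re] using h
    have hlim : Tendsto (fun X : ℝ => (∑ᶠ v ∈ S X, ‖a v - b v‖ ^ 2 * w v) / X) atTop (𝓝 0) := by
      have h := (ha.add hb).sub (hre.const_mul 2)
      rw [show (1 : ℝ) + 1 - 2 * 1 = 0 by norm_num] at h
      refine h.congr fun X => ?_
      rw [hpt X]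
      ring
    refine (Asymptotics.isLittleO_iff_tendsto' ?_).2 hlim
    filter_upwards [eventually_ne_atTop (0 : ℝ)] with X hX hX0
    exact absurd hX0 hX
  -- (2) over ℚ (indeed any number field) there are finitely many places of norm ≤ X
  have hS : ∀ X : ℝ, {v : IsDedekindDomain.HeightOneSpectrum (NumberField.RingOfIntegers ℚ) |
      (v.residueCard : ℝ) ≤ X}.Finite := by
    intro X
    have hN : {v : IsDedekindDomain.HeightOneSpectrum (NumberField.RingOfIntegers ℚ) |
        v.residueCard ≤ ⌈X⌉₊}.Finite :=
      (Ideal.finite_setOf_absNorm_le (S := NumberField.RingOfIntegers ℚ) ⌈X⌉₊).preimage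
        fun _ _ _ _ hvw => IsDedekindDomain.HeightOneSpectrum.ext hvw
    refine hN.subset fun v hv => ?_
    simp only [Set.mem_setOf_eq] at hv ⊢
    exact_mod_cast hv.trans (Nat.le_ceil X)
  -- (3) assembly: the crux ERH (`h₀`, δ-equal to C1's unfolded antecedent) feeds C1, which gives
  -- (π, a) with correlation 1; S1, S2 and `key` give mean-square shadowing; C2 turns it into
  -- `π = π(σ)`; the complementary-sector crux closes the summit statement.
  refine h₅ ?_
  intro σ hirr hico
  obtain ⟨hcpt, π, a, hSat, hcorr⟩ := h₁ h₀ σ hirr hico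
  exact ⟨hcpt, π, h₂ σ hirr hcpt π a hSat
    (key (fun X => {v | (v.residueCard : ℝ) ≤ X}) a (fun v => σ.toGaloisRep.frobTrace v)
      (fun v => Real.log (v.residueCard : ℝ)) hS hcorr (h₃ hcpt π a hSat) (h₄ σ hirr))⟩

end Summit.Langlands.Langlands.Theses.GaloisWeightedBE
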